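import Mathlib.Analysis.Calculus.Taylor
import Mathlib.Analysis.Calculus.ContDiff.Basic
import Mathlib.Analysis.Analytic.Basic
import Mathlib.Analysis.Analytic.ConvergenceRadius
import Mathlib.Analysis.SpecificLimits.Normed
import HarnessLib

/-!
# Real-analyticity in several variables from factorial bounds on the derivatives

The sufficiency half of the characterisation of real-analytic functions of several variables by
derivative bounds (Krantz–Parks, *A Primer of Real Analytic Functions*, 2nd ed., Prop. 2.2.10;
Hörmander, *The Analysis of Linear Partial Differential Operators I*, proof of Thm. 8.4.5 ff.):
a function `f : E → F` (`E`, `F` real normed spaces, `F` complete) of class `C^∞` on an open set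
`U` whose Fréchet derivatives satisfy `‖Dᵏ f(z)‖ ≤ M Cᵏ k!` on `U` is real-analytic on `U`, its
Taylor series `∑ (k!)⁻¹ Dᵏf(x)[y, …, y]` summing to `f (x + y)` on an explicit ball. This is the
calculus step common to all proofs that solutions of analytic elliptic systems are analytic
(Morrey 1958, Friedman 1958; the last step of Müller zum Hagen's 1970 theorem,
`Literature.Geometry.Lorentzian.mullerZumHagen1970_analytic_of_timelikeKilling`). The one-variable
case is `Literature.Analysis.Calculus.hasFPowerSeriesOnBall_of_norm_iteratedDeriv_le`
(`AnalyticOfDerivBound.lean`, for globally smooth `g : ℝ → E`); the present file is local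
(`ContDiffOn` on an open set) and several-variable, and is proved from Mathlib's Taylor formula
with remainder `taylor_mean_remainder_bound` applied to `t ↦ f (x + t • y)`:

* `iteratedDeriv_comp_line` — `(d/dt)ᵏ f(x + t y) = Dᵏf(x + t y)[y, …, y]`;
* `hasFPowerSeriesOnBall_of_norm_iteratedFDeriv_le` — under the bounds on `ball x δ ⊆ U`, the
  series `k ↦ (k!)⁻¹ • iteratedFDeriv ℝ k f x` has radius `≥ (|C| + 1)⁻¹/2` and sums to `f` on the
  ball of radius `min δ ((|C| + 1) 2)⁻¹` about `x`;
* `analyticAt_of_norm_iteratedFDeriv_le`, `analyticOnNhd_of_norm_iteratedFDeriv_le`,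
  `analyticOnNhd_of_locally_norm_iteratedFDeriv_le` — hence analyticity (global and locally
  uniform bounds).

Everything is proved; no definitions, no named facts.

## References

* S. G. Krantz, H. R. Parks, *A Primer of Real Analytic Functions*, 2nd ed., Birkhäuser 2002,
  §2.2, Prop. 2.2.10.
* L. Hörmander, *The Analysis of Linear Partial Differential Operators I*, 2nd ed. (1990), §8.4.
-/

open Set Filter Metric
open scoped Topology ContDiff NNReal ENNReal Nat

noncomputable section

namespace Literature.Analysis.Calculus

variable {E F : Type*} [NormedAddCommGroup E] [NormedSpace ℝ E] [NormedAddCommGroup F]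
  [NormedSpace ℝ F]

/-! ### Derivatives along a line -/

/-- **Derivatives along a line**: for `f` of class `C^∞` on the open set `U` and `x + t • y ∈ U`,
the `k`-th derivative of `t ↦ f (x + t • y)` at `t` is `Dᵏf(x + t • y)[y, …, y]` (chain rule for
the affine map `t ↦ x + t • y`, Mathlib's `ContinuousLinearMap.iteratedFDerivWithin_comp_right`).
[folklore] -/
theorem iteratedDeriv_comp_line {f : E → F} {U : Set E} (hU : IsOpen U) (hf : ContDiffOn ℝ ∞ f U)
    (x y : E) {t : ℝ} (ht : x + t • y ∈ U) (k : ℕ) :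
    iteratedDeriv k (fun s : ℝ ↦ f (x + s • y)) t = iteratedFDeriv ℝ k f (x + t • y) fun _ ↦ y := by
  set L : ℝ →L[ℝ] E := ContinuousLinearMap.toSpanSingleton ℝ y with hL
  have hLapply : ∀ s : ℝ, L s = s • y := fun s ↦ ContinuousLinearMap.toSpanSingleton_apply ℝ y s
  set f₁ : E → F := fun z ↦ f (x + z) with hf₁
  set U₁ : Set E := (fun z ↦ x + z) ⁻¹' U with hU₁
  have hU₁o : IsOpen U₁ := hU.preimage (by fun_prop)
  have hf₁U : ContDiffOn ℝ ∞ f₁ U₁ :=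
    hf.comp (contDiff_const.add contDiff_id).contDiffOn fun z hz ↦ hz
  have hLU : IsOpen (L ⁻¹' U₁) := hU₁o.preimage L.continuous
  have htL : L t ∈ U₁ := by
    show x + L t ∈ U
    rwa [hLapply]
  have hcomp : f₁ ∘ L = fun s : ℝ ↦ f (x + s • y) := by
    funext s
    simp [hf₁, hLapply]
  have h1 := ContinuousLinearMap.iteratedFDerivWithin_comp_right L hf₁U hU₁o.uniqueDiffOn
    hLU.uniqueDiffOn htL (i := k) (by exact_mod_cast le_top)
  rw [iteratedFDerivWithin_of_isOpen k hLU (by exact htL),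
    iteratedFDerivWithin_of_isOpen k hU₁o htL, hcomp] at h1
  rw [iteratedDeriv_eq_iteratedFDeriv, h1, ContinuousMultilinearMap.compContinuousLinearMap_apply,
    hf₁, iteratedFDeriv_comp_add_left, hLapply]
  simp [hLapply]

/-- Norm bound along a line: `‖(d/dt)ᵏ f(x + t y)‖ ≤ ‖Dᵏ f(x + t y)‖ ‖y‖ᵏ`. [folklore] -/
theorem norm_iteratedDeriv_comp_line_le {f : E → F} {U : Set E} (hU : IsOpen U)
    (hf : ContDiffOn ℝ ∞ f U) (x y : E) {t : ℝ} (ht : x + t • y ∈ U) (k : ℕ) :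
    ‖iteratedDeriv k (fun s : ℝ ↦ f (x + s • y)) t‖ ≤
      ‖iteratedFDeriv ℝ k f (x + t • y)‖ * ‖y‖ ^ k := by
  rw [iteratedDeriv_comp_line hU hf x y ht k]
  refine (ContinuousMultilinearMap.le_opNorm _ _).trans (le_of_eq ?_)
  simp

/-! ### The Taylor series sums to the function -/

/-- Under `‖Dᵏf(z)‖ ≤ M Cᵏ k!` the constant `M` is non-negative. [folklore] -/
private theorem nonneg_of_bound {f : E → F} {M C : ℝ} {z : E}
    (hb : ∀ k : ℕ, ‖iteratedFDeriv ℝ k f z‖ ≤ M * C ^ k * k !) : 0 ≤ M := by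
  simpa using (norm_nonneg _).trans (hb 0)

/-- Under `‖Dᵏf(z)‖ ≤ M Cᵏ k!` one has `‖Dᵏf(z)‖ ≤ M |C|ᵏ k!`. [folklore] -/
private theorem bound_abs {f : E → F} {M C : ℝ} {z : E}
    (hb : ∀ k : ℕ, ‖iteratedFDeriv ℝ k f z‖ ≤ M * C ^ k * k !) (k : ℕ) :
    ‖iteratedFDeriv ℝ k f z‖ ≤ M * |C| ^ k * k ! := by
  refine (hb k).trans ?_
  have hM := nonneg_of_bound hb
  have h : C ^ k ≤ |C| ^ k := by rw [← abs_pow]; exact le_abs_self _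
  gcongr

/-- **The Taylor series of a function with factorial derivative bounds converges to it**
(Krantz–Parks 2002, Prop. 2.2.10; Hörmander I, §8.4). Let `f` be `C^∞` on the open set
`U ⊇ ball x δ` (`δ > 0`) with `‖Dᵏ f(z)‖ ≤ M Cᵏ k!` for all `k` and all `z ∈ ball x δ`. Then the
formal multilinear series `k ↦ (k!)⁻¹ • Dᵏf(x)` sums to `f` on the ball of radius
`min δ ((|C| + 1) 2)⁻¹` about `x` (Mathlib's `HasFPowerSeriesOnBall`). Proof: for `‖y‖` that
small, Taylor's formula with remainder for `g(t) = f(x + t y)` on `[0, 1]`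
(`taylor_mean_remainder_bound`, with `g⁽ᵏ⁾(t) = Dᵏf(x + t y)[y,…,y]`, `iteratedDeriv_comp_line`)
bounds the remainder after `N + 1` terms by `M (N + 1) (|C| ‖y‖)^{N+1} → 0`.
[cite: KrantzParks2002, Prop. 2.2.10] -/
theorem hasFPowerSeriesOnBall_of_norm_iteratedFDeriv_le [CompleteSpace F] {f : E → F}
    {U : Set E} (hU : IsOpen U) (hf : ContDiffOn ℝ ∞ f U) {M C δ : ℝ} {x : E} (hδ : 0 < δ)
    (hxU : ball x δ ⊆ U)
    (hb : ∀ k : ℕ, ∀ z ∈ ball x δ, ‖iteratedFDeriv ℝ k f z‖ ≤ M * C ^ k * k !) :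
    HasFPowerSeriesOnBall f (fun k ↦ ((k ! : ℝ))⁻¹ • iteratedFDeriv ℝ k f x) x
      (ENNReal.ofReal (min δ ((|C| + 1) * 2)⁻¹)) := by
  have hx : x ∈ ball x δ := mem_ball_self hδ
  have hb0 : ∀ k : ℕ, ‖iteratedFDeriv ℝ k f x‖ ≤ M * |C| ^ k * k ! :=
    fun k ↦ bound_abs (fun k ↦ hb k x hx) k
  have hM : 0 ≤ M := nonneg_of_bound fun k ↦ hb k x hx
  have hC1 : 0 < |C| + 1 := by positivity
  set ρ₁ : ℝ := ((|C| + 1) * 2)⁻¹ with hρ₁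
  have hρ₁0 : 0 < ρ₁ := by positivity
  set ρ : ℝ := min δ ρ₁ with hρ
  have hρ0 : 0 < ρ := lt_min hδ hρ₁0
  have hρρ₁ : ρ ≤ ρ₁ := min_le_right _ _
  have hρδ : ρ ≤ δ := min_le_left _ _
  -- the coefficients `‖(k!)⁻¹ Dᵏf(x)‖ ≤ M |C|ᵏ`
  have hcoeff : ∀ k : ℕ, ‖((k ! : ℝ))⁻¹ • iteratedFDeriv ℝ k f x‖ ≤ M * |C| ^ k := by
    intro k
    have hk : (0 : ℝ) < k ! := by exact_mod_cast Nat.factorial_pos k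
    rw [norm_smul, norm_inv, Real.norm_eq_abs, abs_of_pos hk, inv_mul_le_iff₀ hk]
    calc ‖iteratedFDeriv ℝ k f x‖ ≤ M * |C| ^ k * k ! := hb0 k
      _ = (k ! : ℝ) * (M * |C| ^ k) := by ring
  -- radius of convergence
  have hrad : ENNReal.ofReal ρ ≤
      FormalMultilinearSeries.radius (𝕜 := ℝ) (E := E) (F := F)
        (fun k ↦ ((k ! : ℝ))⁻¹ • iteratedFDeriv ℝ k f x) := by
    show ((ρ.toNNReal : ℝ≥0) : ℝ≥0∞) ≤ _
    refine FormalMultilinearSeries.le_radius_of_bound _ M fun k ↦ ?_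
    have hrC : |C| * ((ρ.toNNReal : ℝ≥0) : ℝ) ≤ 1 := by
      rw [Real.coe_toNNReal ρ hρ0.le]
      calc |C| * ρ ≤ (|C| + 1) * ρ₁ := by gcongr; linarith
        _ = 2⁻¹ := by rw [hρ₁]; field_simp
        _ ≤ 1 := by norm_num
    calc ‖((k ! : ℝ))⁻¹ • iteratedFDeriv ℝ k f x‖ * ((ρ.toNNReal : ℝ≥0) : ℝ) ^ k
        ≤ M * |C| ^ k * ((ρ.toNNReal : ℝ≥0) : ℝ) ^ k := by
          gcongr
          exact hcoeff k
      _ = M * (|C| * ((ρ.toNNReal : ℝ≥0) : ℝ)) ^ k := by ring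
      _ ≤ M * 1 := by gcongr; exact pow_le_one₀ (by positivity) hrC
      _ = M := mul_one M
  refine ⟨hrad, ENNReal.ofReal_pos.mpr hρ0, fun {y} hy ↦ ?_⟩
  -- `‖y‖ < ρ`
  have hy' : ‖y‖ < ρ := by
    rw [Metric.eball_ofReal, Metric.mem_ball, dist_zero_right] at hy
    exact hy
  have hyδ : ‖y‖ < δ := hy'.trans_le hρδ
  set q : ℝ := |C| * ‖y‖ with hq
  have hq0 : 0 ≤ q := by positivity
  have hq1 : q < 1 := by
    have h2 : (|C| + 1) * ‖y‖ < 1 := by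
      calc (|C| + 1) * ‖y‖ < (|C| + 1) * ρ₁ :=
            (mul_lt_mul_of_pos_left hy' hC1).trans_le (mul_le_mul_of_nonneg_left hρρ₁ hC1.le)
        _ = 2⁻¹ := by rw [hρ₁]; field_simp
        _ ≤ 1 := by norm_num
    nlinarith [abs_nonneg C, norm_nonneg y]
  -- the line `t ↦ x + t • y` stays in the ball for `t ∈ [0, 1]`
  set g : ℝ → F := fun t ↦ f (x + t • y) with hg
  have hseg : ∀ t ∈ Icc (0 : ℝ) 1, x + t • y ∈ ball x δ := by
    intro t ht
    rw [mem_ball, dist_eq_norm, add_sub_cancel_left, norm_smul, Real.norm_eq_abs,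
      abs_of_nonneg ht.1]
    calc t * ‖y‖ ≤ 1 * ‖y‖ := by gcongr; exact ht.2
      _ = ‖y‖ := one_mul _
      _ < δ := hyδ
  set J : Set ℝ := (fun t : ℝ ↦ x + t • y) ⁻¹' U with hJ
  have hJo : IsOpen J := hU.preimage (by fun_prop)
  have hIccJ : Icc (0 : ℝ) 1 ⊆ J := fun t ht ↦ hxU (hseg t ht)
  have hgJ : ContDiffOn ℝ ∞ g J :=
    hf.comp (contDiff_const.add (contDiff_id.smul contDiff_const)).contDiffOn fun t ht ↦ ht
  have hgat : ∀ t ∈ Icc (0 : ℝ) 1, ContDiffAt ℝ ∞ g t := fun t ht ↦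
    hgJ.contDiffAt (hJo.mem_nhds (hIccJ ht))
  -- derivative bounds along the line
  have hgd : ∀ k : ℕ, ∀ t ∈ Icc (0 : ℝ) 1, ‖iteratedDeriv k g t‖ ≤ M * q ^ k * k ! := by
    intro k t ht
    calc ‖iteratedDeriv k g t‖ ≤ ‖iteratedFDeriv ℝ k f (x + t • y)‖ * ‖y‖ ^ k :=
          norm_iteratedDeriv_comp_line_le hU hf x y (hxU (hseg t ht)) k
      _ ≤ M * |C| ^ k * k ! * ‖y‖ ^ k := by
          gcongr
          exact bound_abs (fun k ↦ hb k _ (hseg t ht)) k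
      _ = M * q ^ k * k ! := by rw [hq]; ring
  have hgdw : ∀ k : ℕ, ∀ t ∈ Icc (0 : ℝ) 1,
      ‖iteratedDerivWithin k g (Icc 0 1) t‖ ≤ M * q ^ k * k ! := fun k t ht ↦ by
    rw [iteratedDerivWithin_eq_iteratedDeriv (uniqueDiffOn_Icc zero_lt_one) ((hgat t ht).of_le
      (mod_cast le_top)) ht]
    exact hgd k t ht
  -- the terms of the series and the Taylor polynomial of `g` at `0`, evaluated at `1`
  set a : ℕ → F := fun k ↦ (((k ! : ℝ))⁻¹ • iteratedFDeriv ℝ k f x) fun _ ↦ y with ha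
  have ha' : ∀ k, a k = ((k ! : ℝ))⁻¹ • iteratedDeriv k g 0 := by
    intro k
    show ((k ! : ℝ))⁻¹ • (iteratedFDeriv ℝ k f x fun _ ↦ y) = _
    rw [iteratedDeriv_comp_line hU hf x y (by simpa using hxU hx) k]
    simp
  have htaylor : ∀ N : ℕ, taylorWithinEval g N (Icc 0 1) 0 1 = ∑ k ∈ Finset.range (N + 1), a k := by
    intro N
    rw [taylor_within_apply]
    refine Finset.sum_congr rfl fun k hk ↦ ?_
    have hk : k ≤ N := Nat.lt_succ_iff.mp (Finset.mem_range.mp hk)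
    rw [ha', iteratedDerivWithin_eq_iteratedDeriv (uniqueDiffOn_Icc zero_lt_one)
      ((hgat 0 (left_mem_Icc.2 zero_le_one)).of_le (mod_cast le_top)) (left_mem_Icc.2 zero_le_one)]
    simp
  -- remainder estimate: `‖g 1 - ∑_{k ≤ N} a k‖ ≤ M (N + 1) q^{N+1}`
  have hrem : ∀ N : ℕ, ‖g 1 - ∑ k ∈ Finset.range (N + 1), a k‖ ≤ M * (N + 1) * q ^ (N + 1) := by
    intro N
    have hcd : ContDiffOn ℝ (N + 1) g (Icc 0 1) := fun t ht ↦
      ((hgat t ht).of_le (by exact_mod_cast le_top)).contDiffWithinAt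
    have h := taylor_mean_remainder_bound (f := g) (a := 0) (b := 1) (n := N) zero_le_one hcd
      (right_mem_Icc.2 zero_le_one) (fun t ht ↦ hgdw (N + 1) t ht)
    rw [htaylor N] at h
    simp only [sub_zero, one_pow, mul_one] at h
    refine h.trans (le_of_eq ?_)
    have hN : (N ! : ℝ) ≠ 0 := by exact_mod_cast (Nat.factorial_pos N).ne'
    rw [Nat.factorial_succ, Nat.cast_mul, Nat.cast_add, Nat.cast_one]
    field_simp
  -- summability (geometric domination) and convergence of the partial sums to `g 1 = f (x + y)`
  have hsum : Summable a := by
    refine Summable.of_norm_bounded (g := fun k ↦ M * q ^ k)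
      ((summable_geometric_of_lt_one hq0 hq1).mul_left M) fun k ↦ ?_
    rw [ha]
    calc ‖(((k ! : ℝ))⁻¹ • iteratedFDeriv ℝ k f x) fun _ ↦ y‖
        ≤ ‖((k ! : ℝ))⁻¹ • iteratedFDeriv ℝ k f x‖ * ∏ _i : Fin k, ‖y‖ :=
          ContinuousMultilinearMap.le_opNorm _ _
      _ ≤ M * |C| ^ k * ‖y‖ ^ k := by
          rw [Finset.prod_const, Finset.card_univ, Fintype.card_fin]
          gcongr
          exact hcoeff k
      _ = M * q ^ k := by rw [hq]; ring
  have hlim : Tendsto (fun N ↦ ∑ k ∈ Finset.range N, a k) atTop (𝓝 (g 1)) := by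
    rw [← tendsto_add_atTop_iff_nat 1]
    refine tendsto_iff_norm_sub_tendsto_zero.mpr ?_
    have hzero : Tendsto (fun N : ℕ ↦ M * (N + 1) * q ^ (N + 1)) atTop (𝓝 0) := by
      have h := (tendsto_self_mul_const_pow_of_lt_one hq0 hq1).comp (tendsto_add_atTop_nat 1)
      have h' := h.const_mul M
      rw [mul_zero] at h'
      refine h'.congr fun N ↦ ?_
      simp [Function.comp, mul_assoc]
    refine squeeze_zero (fun N ↦ norm_nonneg _) (fun N ↦ ?_) hzero
    rw [norm_sub_rev]
    exact hrem N
  have hg1 : g 1 = f (x + y) := by simp [hg]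
  rw [← hg1]
  have heq : ∑' k, a k = g 1 := tendsto_nhds_unique hsum.hasSum.tendsto_sum_nat hlim
  rw [← heq]
  exact hsum.hasSum

/-- **Real-analyticity at a point from factorial derivative bounds on a ball** (Krantz–Parks 2002,
Prop. 2.2.10). [cite: KrantzParks2002, Prop. 2.2.10] -/
theorem analyticAt_of_norm_iteratedFDeriv_le [CompleteSpace F] {f : E → F} {U : Set E}
    (hU : IsOpen U) (hf : ContDiffOn ℝ ∞ f U) {M C δ : ℝ} {x : E} (hδ : 0 < δ)
    (hxU : ball x δ ⊆ U)
    (hb : ∀ k : ℕ, ∀ z ∈ ball x δ, ‖iteratedFDeriv ℝ k f z‖ ≤ M * C ^ k * k !) :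
    AnalyticAt ℝ f x :=
  ⟨_, _, hasFPowerSeriesOnBall_of_norm_iteratedFDeriv_le hU hf hδ hxU hb⟩

/-- **Real-analyticity from locally uniform factorial derivative bounds** (Krantz–Parks 2002,
Prop. 2.2.10): if `f` is `C^∞` on the open set `U` and every point of `U` has a ball in `U` on
which `‖Dᵏ f‖ ≤ M Cᵏ k!` for some constants `M`, `C`, then `f` is real-analytic on `U`.
[cite: KrantzParks2002, Prop. 2.2.10] -/
theorem analyticOnNhd_of_locally_norm_iteratedFDeriv_le [CompleteSpace F] {f : E → F}
    {U : Set E} (hU : IsOpen U) (hf : ContDiffOn ℝ ∞ f U)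
    (hb : ∀ x ∈ U, ∃ δ > (0 : ℝ), ∃ M C : ℝ, ball x δ ⊆ U ∧
      ∀ k : ℕ, ∀ z ∈ ball x δ, ‖iteratedFDeriv ℝ k f z‖ ≤ M * C ^ k * k !) :
    AnalyticOnNhd ℝ f U := by
  intro x hx
  obtain ⟨δ, hδ, M, C, hxU, hb'⟩ := hb x hx
  exact analyticAt_of_norm_iteratedFDeriv_le hU hf hδ hxU hb'

/-- **Real-analyticity from uniform factorial derivative bounds** (Krantz–Parks 2002,
Prop. 2.2.10): if `f` is `C^∞` on the open set `U` with `‖Dᵏ f(z)‖ ≤ M Cᵏ k!` for all `k` and all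
`z ∈ U`, then `f` is real-analytic on `U`. [cite: KrantzParks2002, Prop. 2.2.10] -/
theorem analyticOnNhd_of_norm_iteratedFDeriv_le [CompleteSpace F] {f : E → F} {U : Set E}
    (hU : IsOpen U) (hf : ContDiffOn ℝ ∞ f U) {M C : ℝ}
    (hb : ∀ k : ℕ, ∀ z ∈ U, ‖iteratedFDeriv ℝ k f z‖ ≤ M * C ^ k * k !) :
    AnalyticOnNhd ℝ f U := by
  refine analyticOnNhd_of_locally_norm_iteratedFDeriv_le hU hf fun x hx ↦ ?_
  obtain ⟨δ, hδ, hδU⟩ := Metric.isOpen_iff.1 hU x hx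
  exact ⟨δ, hδ, M, C, hδU, fun k z hz ↦ hb k z (hδU hz)⟩

end Literature.Analysis.Calculus
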